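import Summits.ABC.IUTFork.Repair.CandInternal42Derivable
import Summits.ABC.IUTFork.Cor312PinnedHonestReal
import HarnessLib

/-!
# IUT REPAIR branch (LADDER-ABC:A2.RP ⊆ A2.B) — REAL COLUMN for the interface-derivable class: the GENUINE print-normalised setting
# (seat abc-iut-rp-d4, batch 2; REAL-column first-refusal holder per the lead's FOLD #3 11:15:43Z)

Proof-only file (D-0012: 0 definitions, 0 `Prop` facts; imports `Repair/CandInternal42Derivable` and abc-iut-C-cert's `Cor312PinnedHonestReal`
BY NAME, edits none). TAKES NO SIDE on [IUTchIII] Cor. 3.12 or on any author; nothing here asserts abc or Cor. 3.12 proved or refuted;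
CANDIDATES ARE HYPOTHESES — typed ≠ proved, instantiated ≠ endorsed.

OBJECT (REPAIR-SPEC v0.5 §3 «T-c STANDING OBSTRUCTION AT GENUINE DATA», director-abc (E4)). `Cor312PinnedHonestReal.
not_pilotKummerIndRelated_settingPrVolSharp_of_pinned3` (p430714) refutes S at the GENUINE assembled real setting `settingPrVolSharp` (abc-iut-c312-7)
over `LatticeSituation.ofShells (logShellsDH X logv) …` (abc-iut-c312-5) with the packet-normalised container `summandPiecesPr` (abc-iut-c312-1),
for EVERY region reading `ρ` and q-datum `qK`, from: REALISING IDELES (`ht0/ht`, `htq0/htq1/htq`) ∧ (ii)(b) at column `n` ∧ the two pins — with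
Step (x) isometry, honest `j²`-scaling, label-independent q-volume and `|log(q)| > 0` THEOREMS of that setting. This file is the REAL-COLUMN CELL of
the interface-derivable class (`CandInternal42Derivable.derivable_joint`, 21 readings across sub-cells B0–B3): at that same genuine setting,
granting in addition Thm. 3.11 (i) `MultiradialCompat` and (ii) `PartII` of the real lattice situation (E4-type hypotheses on the free column data,
named), the bridge hypotheses (a THEOREM there from `ThetaFinite` + Θ-ideles units off `S`, abc-iut-c312-6/C-cert
`bridgeHyps_settingPrVolSharp`; taken here as a binder to keep the statement short) and the THREE pins, the twenty-one readings HOLD JOINTLY while S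
FAILS — `derivable_joint_and_not_residual_settingPrVolSharp`. So on genuine data the derivable class is idle against S; its `breaks` cell reads
«n/a (HOLDS at the genuine setting; nothing given up)». Interface/real level; no judgement on print.
[claim: Mochizuki2012, status: disputed] [cite: DupuyHilado2025, §3.3–§3.4, Thm. 3.10.1] [cite: ScholzeStix2018, §2.2 pp. 9–10]
-/

noncomputable section

open Set Function NumberField IsDedekindDomain

namespace Summit.ABC.IUTFork.Repair.CandInternal42DerivableReal

open Thm311 Thm311.Real Cor312 Cor312Vol Literature.IUT.LogThetaLattice Literature.IUT.LogVolume Literature.IUT.HodgeTheaters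
open Cor312Vol.PinnedHonestReal

variable {F : Type} [Field F] [NumberField F] (X : PilotData F) {logv : PadicLogs F} (hlog : LogvAnalytic logv)
  (M : Type) [Field M] [NumberField M]
  (archPk : ∀ (j : (thetaIndex X).Label) (vQ : (thetaIndex X).VQ), Set ((logShellsDH X logv).Packet j vQ))
  (archSub : ∀ (j : (thetaIndex X).Label) (v : (thetaIndex X).V),
    Set ((logShellsDH X logv).Packet j ((thetaIndex X).over v)))
  (Ψ : ℤ → ∀ v : (thetaIndex X).V, v ∈ (thetaIndex X).Vbad → Set ((logShellsDH X logv).StarPacket v))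
  (act : ℤ → ∀ v : (thetaIndex X).V, v ∈ (thetaIndex X).Vbad →
    (logShellsDH X logv).StarPacket v → Module.End ℚ ((logShellsDH X logv).StarPacket v))
  (Mmod : ℤ → ∀ j : (thetaIndex X).LabelStar, Set ((logShellsDH X logv).GlobalPacket j.1))
  (region : ℤ → ∀ j : (thetaIndex X).LabelStar, FinDivisor M → ∀ vQ : (thetaIndex X).VQ,
    Set ((logShellsDH X logv).Packet j.1 vQ))
  (frobAdm : ℤ → ℤ → ∀ (j : (thetaIndex X).Label) (vQ : (thetaIndex X).VQ),
    Set ((logShellsDH X logv).Packet j vQ) → Prop)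
  (frobLogvol : ℤ → ℤ → ∀ (j : (thetaIndex X).Label) (vQ : (thetaIndex X).VQ),
    Set ((logShellsDH X logv).Packet j vQ) → ℝ)
  (frobΨ : ℤ → ℤ → ∀ v : (thetaIndex X).V, v ∈ (thetaIndex X).Vbad → Set ((logShellsDH X logv).StarPacket v))
  (frobMmod : ℤ → ℤ → ∀ j : (thetaIndex X).LabelStar, Set ((logShellsDH X logv).GlobalPacket j.1))
  (unitImage : ℤ → ℤ → ℕ → ∀ (j : (thetaIndex X).Label) (vQ : (thetaIndex X).VQ),
    Set ((logShellsDH X logv).Packet j vQ))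
  (ballImage : ℤ → ℤ → ∀ (j : (thetaIndex X).Label) (vQ : (thetaIndex X).VQ),
    Set ((logShellsDH X logv).Packet j vQ))
  (thetaDiv : ℤ → ℤ → LgpDivisor M (thetaIndex X).lstar)
  (n : ℤ) {HT : Type} {LogLink : HT → HT → Type} {IsFull : ∀ {s t : HT}, LogLink s t → Prop}
  (lat : LGPGaussianLogThetaLattice LogLink IsFull)
  {Frd : Type} {IsoF : Frd → Frd → Type} {Ob : Frd → Type} {realify : Frd → Frd} {Strip : Type}
  {IsoS : Strip → Strip → Type} {Mv : ∀ v : (thetaIndex X).V, v ∈ (thetaIndex X).Vbad → Type}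
  [∀ v h, Monoid (Mv v h)]
  (sig : GlobalLGPFrobenioidSignature (thetaIndex X).lstar (thetaIndex X).V (· ∈ (thetaIndex X).Vbad)
    Frd IsoF Ob realify Strip IsoS Mv)
  (split : SplittingMonoids Mv) {ObΔ : Type} {N : ∀ v : (thetaIndex X).V, v ∈ (thetaIndex X).Vbad → Type}
  [∀ v h, Monoid (N v h)] (qData : QPilotData ObΔ N)
  (t : ∀ (pp : Nat.Primes) (_ : Fin X.lstar) (x : (thetaIndex X).Fibre (.inr pp)),
    haveI : Fact (pp : ℕ).Prime := ⟨pp.2⟩; kOf X pp.1 x)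
  (tq : ∀ (pp : Nat.Primes) (x : (thetaIndex X).Fibre (.inr pp)), haveI : Fact (pp : ℕ).Prime := ⟨pp.2⟩; kOf X pp.1 x)
  (ρ : (∀ v : (thetaIndex X).V, v ∈ (thetaIndex X).Vbad → Set ((logShellsDH X logv).StarPacket v)) →
    ∀ (j : (thetaIndex X).Label) (vQ : (thetaIndex X).VQ), Set ((logShellsDH X logv).Packet j vQ))
  (qK : ∀ v : (thetaIndex X).V, v ∈ (thetaIndex X).Vbad → Set ((logShellsDH X logv).StarPacket v))

/-- **`derivable_joint_and_not_residual_settingPrVolSharp` — THE REAL-COLUMN CELL OF THE DERIVABLE CLASS.** At abc-iut-c312-7's genuine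
print-normalised setting `settingPrVolSharp` with REALISING ideles, for every region reading `ρ` and q-datum `qK`: granting Thm. 3.11 (i)
`MultiradialCompat` and (ii) `PartII` of the real lattice situation, the bridge hypotheses and the three pins, the twenty-one interface-derivable
census readings hold JOINTLY and the residual S FAILS. Inputs used as THEOREMS of the setting (not hypotheses): Step (x)
(`SummandPieces.adm_iff_and_logvolInvariant_of_generators` with `realizes_situationPrVol` / `generatorsPreserve_summandPiecesPr`), admissible
(Ind3)-regions (`adm_thetaRegion3_sharp_Pr`), honest `j²`-scaling (`scaled_settingPrVolSharp`), label-independent q-volume (c312-7's closed forms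
`qLocal_settingPrVol_qCentreDH_inl/_inr`), `|log(q)| > 0` (`absLogQPos_settingPrVolSharp`). [cite: DupuyHilado2025, §3.3–§3.4, Thm. 3.10.1] -/
theorem derivable_joint_and_not_residual_settingPrVolSharp (ht0 : ∀ pp i x, t pp i x ≠ 0)
    (ht : ∀ (pp : Nat.Primes) (i : Fin X.lstar) (x : (thetaIndex X).Fibre (.inr pp)),
      haveI : Fact (pp : ℕ).Prime := ⟨pp.2⟩
      Real.log ‖t pp i x‖ = -(X.thetaPilot i (placeOf X pp.1 x)) * logNorm F (placeOf X pp.1 x) /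
        localDegree F (placeOf X pp.1 x))
    (htq0 : ∀ pp x, tq pp x ≠ 0)
    (htq1 : ∀ (pp : Nat.Primes) (x : (thetaIndex X).Fibre (.inr pp)),
      haveI : Fact (pp : ℕ).Prime := ⟨pp.2⟩; placeOf X pp.1 x ∉ X.S → ‖tq pp x‖ = 1)
    (htq : ∀ (pp : Nat.Primes) (x : (thetaIndex X).Fibre (.inr pp)),
      haveI : Fact (pp : ℕ).Prime := ⟨pp.2⟩
      Real.log ‖tq pp x‖ = -(X.qPilot (placeOf X pp.1 x)) * logNorm F (placeOf X pp.1 x) /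
        localDegree F (placeOf X pp.1 x))
    (hMR : (LatticeSituation.ofShells (logShellsDH X logv) M archPk archSub (summandPiecesPr X hlog).Adm
        (summandPiecesPr X hlog).logvol Ψ act Mmod region frobAdm frobLogvol frobΨ frobMmod unitImage ballImage thetaDiv).MultiradialCompat)
    (hII : (LatticeSituation.ofShells (logShellsDH X logv) M archPk archSub (summandPiecesPr X hlog).Adm
        (summandPiecesPr X hlog).logvol Ψ act Mmod region frobAdm frobLogvol frobΨ frobMmod unitImage ballImage thetaDiv).PartII)
    (hB : BridgeHyps (settingPrVolSharp X hlog M archPk archSub Ψ act Mmod region n lat sig split qData tq t htq0 htq1))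
    (hpin : Cor312Vol.PinnedRegions3
      (LatticeSituation.ofShells (logShellsDH X logv) M archPk archSub (summandPiecesPr X hlog).Adm
        (summandPiecesPr X hlog).logvol Ψ act Mmod region frobAdm frobLogvol frobΨ frobMmod unitImage ballImage thetaDiv)
      (settingPrVolSharp X hlog M archPk archSub Ψ act Mmod region n lat sig split qData tq t htq0 htq1) ρ qK) :
    (CandInternal2.HQPrecise (LatticeSituation.ofShells (logShellsDH X logv) M archPk archSub (summandPiecesPr X hlog).Adm
        (summandPiecesPr X hlog).logvol Ψ act Mmod region frobAdm frobLogvol frobΨ frobMmod unitImage ballImage thetaDiv) (settingPrVolSharp X hlog M archPk archSub Ψ act Mmod region n lat sig split qData tq t htq0 htq1) ∧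
      CandInternal2.HNonInterference (LatticeSituation.ofShells (logShellsDH X logv) M archPk archSub (summandPiecesPr X hlog).Adm
        (summandPiecesPr X hlog).logvol Ψ act Mmod region frobAdm frobLogvol frobΨ frobMmod unitImage ballImage thetaDiv) (settingPrVolSharp X hlog M archPk archSub Ψ act Mmod region n lat sig split qData tq t htq0 htq1) ∧
      CandInternal40.HAlienColumn (LatticeSituation.ofShells (logShellsDH X logv) M archPk archSub (summandPiecesPr X hlog).Adm
        (summandPiecesPr X hlog).logvol Ψ act Mmod region frobAdm frobLogvol frobΨ frobMmod unitImage ballImage thetaDiv) (settingPrVolSharp X hlog M archPk archSub Ψ act Mmod region n lat sig split qData tq t htq0 htq1) ρ ∧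
      CandInternal40.HInd3Origin (LatticeSituation.ofShells (logShellsDH X logv) M archPk archSub (summandPiecesPr X hlog).Adm
        (summandPiecesPr X hlog).logvol Ψ act Mmod region frobAdm frobLogvol frobΨ frobMmod unitImage ballImage thetaDiv) (settingPrVolSharp X hlog M archPk archSub Ψ act Mmod region n lat sig split qData tq t htq0 htq1) ∧
      CandInternal41.HUnitCoric (LatticeSituation.ofShells (logShellsDH X logv) M archPk archSub (summandPiecesPr X hlog).Adm
        (summandPiecesPr X hlog).logvol Ψ act Mmod region frobAdm frobLogvol frobΨ frobMmod unitImage ballImage thetaDiv) (settingPrVolSharp X hlog M archPk archSub Ψ act Mmod region n lat sig split qData tq t htq0 htq1) ∧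
      CandMochizuki2.H (LatticeSituation.ofShells (logShellsDH X logv) M archPk archSub (summandPiecesPr X hlog).Adm
        (summandPiecesPr X hlog).logvol Ψ act Mmod region frobAdm frobLogvol frobΨ frobMmod unitImage ballImage thetaDiv) (settingPrVolSharp X hlog M archPk archSub Ψ act Mmod region n lat sig split qData tq t htq0 htq1) (fun _ => (settingPrVolSharp X hlog M archPk archSub Ψ act Mmod region n lat sig split qData tq t htq0 htq1).possibleImages) ∧
      CandMochizuki33.AO1 (LatticeSituation.ofShells (logShellsDH X logv) M archPk archSub (summandPiecesPr X hlog).Adm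
        (summandPiecesPr X hlog).logvol Ψ act Mmod region frobAdm frobLogvol frobΨ frobMmod unitImage ballImage thetaDiv) (settingPrVolSharp X hlog M archPk archSub Ψ act Mmod region n lat sig split qData tq t htq0 htq1) ρ qK ∧
      CandMochizuki33.AO2 (LatticeSituation.ofShells (logShellsDH X logv) M archPk archSub (summandPiecesPr X hlog).Adm
        (summandPiecesPr X hlog).logvol Ψ act Mmod region frobAdm frobLogvol frobΨ frobMmod unitImage ballImage thetaDiv) (settingPrVolSharp X hlog M archPk archSub Ψ act Mmod region n lat sig split qData tq t htq0 htq1) ρ qK ∧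
      CandExplicit1.H_Stp (LatticeSituation.ofShells (logShellsDH X logv) M archPk archSub (summandPiecesPr X hlog).Adm
        (summandPiecesPr X hlog).logvol Ψ act Mmod region frobAdm frobLogvol frobΨ frobMmod unitImage ballImage thetaDiv) (settingPrVolSharp X hlog M archPk archSub Ψ act Mmod region n lat sig split qData tq t htq0 htq1) ρ ∧
      CandExplicit3.H_coric (LatticeSituation.ofShells (logShellsDH X logv) M archPk archSub (summandPiecesPr X hlog).Adm
        (summandPiecesPr X hlog).logvol Ψ act Mmod region frobAdm frobLogvol frobΨ frobMmod unitImage ballImage thetaDiv) (settingPrVolSharp X hlog M archPk archSub Ψ act Mmod region n lat sig split qData tq t htq0 htq1) ∧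
      CandExplicit3.H_Ind3 (LatticeSituation.ofShells (logShellsDH X logv) M archPk archSub (summandPiecesPr X hlog).Adm
        (summandPiecesPr X hlog).logvol Ψ act Mmod region frobAdm frobLogvol frobΨ frobMmod unitImage ballImage thetaDiv) (settingPrVolSharp X hlog M archPk archSub Ψ act Mmod region n lat sig split qData tq t htq0 htq1) ∧
      CandExplicit5.H_U03 (LatticeSituation.ofShells (logShellsDH X logv) M archPk archSub (summandPiecesPr X hlog).Adm
        (summandPiecesPr X hlog).logvol Ψ act Mmod region frobAdm frobLogvol frobΨ frobMmod unitImage ballImage thetaDiv) (settingPrVolSharp X hlog M archPk archSub Ψ act Mmod region n lat sig split qData tq t htq0 htq1) ρ qK ∧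
      CandExplicit5.H_U04 (LatticeSituation.ofShells (logShellsDH X logv) M archPk archSub (summandPiecesPr X hlog).Adm
        (summandPiecesPr X hlog).logvol Ψ act Mmod region frobAdm frobLogvol frobΨ frobMmod unitImage ballImage thetaDiv) (settingPrVolSharp X hlog M archPk archSub Ψ act Mmod region n lat sig split qData tq t htq0 htq1) ∧
      CandExplicit5.H_U05 (LatticeSituation.ofShells (logShellsDH X logv) M archPk archSub (summandPiecesPr X hlog).Adm
        (summandPiecesPr X hlog).logvol Ψ act Mmod region frobAdm frobLogvol frobΨ frobMmod unitImage ballImage thetaDiv) (settingPrVolSharp X hlog M archPk archSub Ψ act Mmod region n lat sig split qData tq t htq0 htq1) ∧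
      CandExplicit8.H (LatticeSituation.ofShells (logShellsDH X logv) M archPk archSub (summandPiecesPr X hlog).Adm
        (summandPiecesPr X hlog).logvol Ψ act Mmod region frobAdm frobLogvol frobΨ frobMmod unitImage ballImage thetaDiv) (settingPrVolSharp X hlog M archPk archSub Ψ act Mmod region n lat sig split qData tq t htq0 htq1) 0 ∧
      CandJoshi4.Hnorm (LatticeSituation.ofShells (logShellsDH X logv) M archPk archSub (summandPiecesPr X hlog).Adm
        (summandPiecesPr X hlog).logvol Ψ act Mmod region frobAdm frobLogvol frobΨ frobMmod unitImage ballImage thetaDiv) (settingPrVolSharp X hlog M archPk archSub Ψ act Mmod region n lat sig split qData tq t htq0 htq1) ∧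
      CandJoshi4.Hfin (settingPrVolSharp X hlog M archPk archSub Ψ act Mmod region n lat sig split qData tq t htq0 htq1) ∧
      CandJoshi6.H1a (thetaIndex X) ∧
      CandJoshi6.H1b (LatticeSituation.ofShells (logShellsDH X logv) M archPk archSub (summandPiecesPr X hlog).Adm
        (summandPiecesPr X hlog).logvol Ψ act Mmod region frobAdm frobLogvol frobΨ frobMmod unitImage ballImage thetaDiv) (settingPrVolSharp X hlog M archPk archSub Ψ act Mmod region n lat sig split qData tq t htq0 htq1) ∧
      CandJoshi6.H2 (LatticeSituation.ofShells (logShellsDH X logv) M archPk archSub (summandPiecesPr X hlog).Adm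
        (summandPiecesPr X hlog).logvol Ψ act Mmod region frobAdm frobLogvol frobΨ frobMmod unitImage ballImage thetaDiv) (settingPrVolSharp X hlog M archPk archSub Ψ act Mmod region n lat sig split qData tq t htq0 htq1) ∧
      CandJoshi6.H3 (LatticeSituation.ofShells (logShellsDH X logv) M archPk archSub (summandPiecesPr X hlog).Adm
        (summandPiecesPr X hlog).logvol Ψ act Mmod region frobAdm frobLogvol frobΨ frobMmod unitImage ballImage thetaDiv) (settingPrVolSharp X hlog M archPk archSub Ψ act Mmod region n lat sig split qData tq t htq0 htq1)) ∧
    ¬ Cor312Vol.PilotKummerIndRelated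
      (LatticeSituation.ofShells (logShellsDH X logv) M archPk archSub (summandPiecesPr X hlog).Adm
        (summandPiecesPr X hlog).logvol Ψ act Mmod region frobAdm frobLogvol frobΨ frobMmod unitImage ballImage thetaDiv)
      (settingPrVolSharp X hlog M archPk archSub Ψ act Mmod region n lat sig split qData tq t htq0 htq1) ρ qK := by
  -- Step (x): (Ind1)(Ind2)-invariance of admissibility and log-volume for the packet-normalised container
  have hgen := SummandPieces.adm_iff_and_logvolInvariant_of_generators
    (realizes_situationPrVol X hlog M archPk archSub Ψ act Mmod region n) (generatorsPreserve_summandPiecesPr X hlog)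
  refine CandInternal42Derivable.derivable_joint_and_not_residual_of_honest
    (LatticeSituation.ofShells (logShellsDH X logv) M archPk archSub (summandPiecesPr X hlog).Adm
        (summandPiecesPr X hlog).logvol Ψ act Mmod region frobAdm frobLogvol frobΨ frobMmod unitImage ballImage thetaDiv)
    (settingPrVolSharp X hlog M archPk archSub Ψ act Mmod region n lat sig split qData tq t htq0 htq1) ρ qK hMR hII hB hpin
    hgen.1 hgen.2 ?_ ?_ ?_ ?_
  · -- the (Ind3)-enlarged Θ-region is admissible
    intro j vQ
    exact adm_thetaRegion3_sharp_Pr X hlog M archPk archSub Ψ act Mmod region n lat sig split qData _ _ _ t ht0 j vQ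
  · -- honest j²-scaling
    exact scaled_settingPrVolSharp X hlog M archPk archSub Ψ act Mmod region n lat sig split qData t tq ht0 ht htq0 htq1 htq
  · -- the q-volume does not depend on the label
    intro i i' vQ
    cases vQ with
    | inl u =>
      exact (qLocal_settingPrVol_qCentreDH_inl X hlog M archPk archSub Ψ act Mmod region n lat sig split qData _ tq htq0 _
          (Setting.labelSucc i) u).trans
        (qLocal_settingPrVol_qCentreDH_inl X hlog M archPk archSub Ψ act Mmod region n lat sig split qData _ tq htq0 _
          (Setting.labelSucc i') u).symm
    | inr pp =>
      exact (qLocal_settingPrVol_qCentreDH_inr X hlog M archPk archSub Ψ act Mmod region n lat sig split qData _ tq htq0 _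
          htq (Setting.labelSucc i) pp).trans
        (qLocal_settingPrVol_qCentreDH_inr X hlog M archPk archSub Ψ act Mmod region n lat sig split qData _ tq htq0 _
          htq (Setting.labelSucc i') pp).symm
  · -- |log(q)| > 0
    exact absLogQPos_settingPrVolSharp X hlog M archPk archSub Ψ act Mmod region n lat sig split qData t tq htq0 htq1 htq

end Summit.ABC.IUTFork.Repair.CandInternal42DerivableReal

end
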